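import Summits.QuantumFields.YangMills.Theorems.UnitScaleTiltProp7SPrintCond135
import Summits.QuantumFields.YangMills.Theorems.UnitScaleTiltProp7ChartPrint
import Summits.QuantumFields.YangMills.Theorems.UnitScaleTiltMinimiserStabilityRegPrPV3E
import HarnessLib

/-!
# Route `UnitScaleTilt`, crux K1 child «MinimiserStabilityRegPr» (stmt-QuantumFields-19200), skeleton birth_v8 5b4e8467… ∕ v9 (OWNER RULING g24-№3) —
# ROW (E′) ON PRINT'S OWN ROUTE, BY NAME: E′ ⇐ [Balaban1985RegularSpaces] THEOREM 2 AT THE CRITICAL BACKGROUND (the cell's socket `hT2`, shared with row A)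
# ∧ ONE SECT.-E STATEMENT «(142): every point of the Landau-gauge chart (19)–(21) around an R2-critical configuration that lies in (6)(e) ∩ 𝔅_k(V) has
# action ≥ the critical value»

Cell `ym3-torus`, width seat `ym-ust-19200-w4` (gen 0; OWNER socket list 2026-08-28 00:34Z: «PRINT'S OWN ROUTE (preferred, independent of ATT) … chart
surjectivity = row A»).  YM₃ on T³ is a ladder rung (R3), not the Clay problem; nothing here is a claim about the crux, d = 4 or the mass gap, and the registered
row E′ is NOT closed by this file (helper landing, `--supports`): it is reduced to two named inputs.

THE ROUTE (p. 299 of [Balaban1985Variational], verbatim: «To see that U_k is a minimum we apply the whole procedure with the configuration U_k instead of U₀»).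
Given a reading-R2 critical `U ∈ (6)(e) ∩ 𝔅_k(V)` and a competitor `W ∈ (6)(e) ∩ 𝔅_k(V)`:
 (1) a representative `W^v`, `v` in print's group (4) (`v↓ = 1`), in the based axial gauge (1.19) relative to `U` — the cell's Sect. A law
     `Prop7ChartPrint.axialRepr_print_based_uniform` (fleet seat p1 ∕ [Balaban1985RegularSpaces] p. 79), threshold `min{1/(6C₀(3)), c₂′(3,L)/4}`;
 (2) hypothesis (1.35) of Thm 2 for the pair `(U, W^v)` with `α₁ = e + C_L·2e` — width seat w1's `Prop7SPrintCond135.cond135_based_of_sat14_mem` (the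
     background `U` lies IN the fibre, so `|Ū − V| < e` for free), thresholds `e ≤ (10⁸L³)⁻¹`;
 (3) THEOREM 2 (the cell's socket `hT2`, = the binder of w1's `Prop7SPrintCond135.prop2Printed_sPrint_of_thm2`, VERBATIM; general regular competitor — this is
     the p. 280 sentence «each configuration U from (18) can be represented as (U₁U₀)^{u⁻¹}», NOT Prop. 2's sentence on critical orbits that row A's text
     `B11.Prop2Printed` records): `W^v = (U₁U)^u`, `u` (1.29)-restricted, `U₁ = e^{iηA}` with (1.36)–(1.39) at `α₀ + α₁ = (2 + 2C_L)e`;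
 (4) THE SECT.-E STATEMENT (142) DISPLAYED AS HYPOTHESIS `hco`: at an R2-critical `U ∈ (6)(e) ∩ 𝔅_k(V)`, every such chart point whose `u`-image lies in
     (6)(e) ∩ 𝔅_k(V) has `A(U₁U) ≥ A(U)` (print: `𝔉(A′) = A(U_k) + ½⟨A′, Δ₁A′⟩ + V(A′)`, `Δ₁` positive definite on `{QA′ = 0, RD^*A′ = 0}`, p. 299);
 (5) gauge invariance of (5): `A(W) = A(W^v) = A((U₁U)^u) = A(U₁U) ≥ A(U)`.

WHAT IS PROVED (sorry-free, no definition; ns `…Theorems.PV3EChart`).  **`isMinOn_regFibrePr_of_thm2_coercive142_at`** (steps (1)–(5) at one member and one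
datum, thresholds displayed) and **`stub_PV3E_of_thm2_coercive142 : hT2 → hco → <E′ text verbatim>`** (`e₅` = the six-fold minimum of the thresholds, `a₁'' = 1`;
the (7)-datum, the (14)-background `U₀` and the window of E′ are idle on this route too — cf. `PV3E.stub_PV3E_of_relSchemaE` for the chart-free twin).

LOCATED REMARK (owner's call): on this route row E′'s residual beyond the socket `hT2` (lit-balaban G-B8-T2S, `thm2TorusAt_exists_of_letters`, read at the
CRITICAL background — whose strong regularity (1.33) «(3.35) in [4]» is print's Thm 1 (9) for `U_k`) is EXACTLY `hco`, a statement in the Sect. C–E letters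
that row C's line (width seat w2: `𝔊(U₀)`, `H₁(U₀)`, `Δ₁`) types; no other input.

HONEST SCOPE.  Bookkeeping over the cell's Sect. A laws and letters; `hT2` and `hco` are displayed hypotheses, not proved; nothing of [Balaban1985Variational] ∕
[Balaban1985RegularSpaces] is asserted; `--supports stmt-QuantumFields-19200`, count-neutral.

References: T. Bałaban, CMP 102 (1985) 277–309 [Balaban1985Variational] ((4)–(6) p.278, (14)–(18) p.280, (19)–(21) and Prop. 2 p.281, (141)–(143) and Prop. 7
p.299); CMP 99 (1985) 75–102 [Balaban1985RegularSpaces] ((1.19) p.79, (1.29) p.81, (1.33)–(1.39) pp.82–83, Thm 2 p.83); CMP 98 (1985) 17–51 [Balaban1985Averaging]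
(Prop. 2 p.27).
-/

noncomputable section

open scoped BigOperators Matrix.Norms.L2Operator

namespace Summit.QuantumFields.YangMills.Theorems.PV3EChart

open NormedSpace
open Literature.MathematicalPhysics.QuantumFieldTheory.Balaban1983to89
open Literature.MathematicalPhysics.QuantumFieldTheory.Balaban1983to89.T3ContinuumYM3Torus
open Literature.MathematicalPhysics.QuantumFieldTheory.Balaban1983to89.T3UnitLawDensityEML (ℰp)
open Literature.MathematicalPhysics.QuantumFieldTheory.Balaban1983to89.T3ConstrainedMinimiser (fibre)
open Literature.MathematicalPhysics.QuantumFieldTheory.Balaban1983to89.T3PrintedRegularMinimiser (RegPr regFibrePr mem_regFibrePr_iff)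
open Literature.MathematicalPhysics.QuantumFieldTheory.Balaban1983to89.T3PrintedRegularOrbits (descTransf regPr_gaugeAct_iff
  gaugeAct_mem_regFibrePr_iff_of_trivial)
open Literature.MathematicalPhysics.QuantumFieldTheory.Balaban1983to89.T3Thm1Carrier
open Literature.MathematicalPhysics.QuantumFieldTheory.Balaban1983to89.T3Thm1CarrierNative (IsCritR2)
open B7Prop1Explicit renaming Site → LSite
open B7Prop2Explicit (C0 c2' C0_pos c2'_pos)
open B8Eq119TwistedAxial (InAx)
open B8Thm4TorusAt (torusLam)
open B8Thm2TorusAt (Cond135T)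
open B15DeterminingSets (embIter)
open B10Eq27TorusAxialLog (pull unitsField toUField)
open T3SectALandauChart (pert emb15 eta bgUnits CloseAvg Sat14T3 pos_of_regPr closeAvg_of_mem_fibre)
open Summit.QuantumFields.YangMills.Theorems.Prop7SPrint (basePt IsAxialPrint RestrictedPrint)
open Summit.QuantumFields.YangMills.Theorems.Prop7SPrintCond135 (cond135_based_of_sat14_mem)
open Summit.QuantumFields.YangMills.Theorems.Prop7ChartPrint (axialRepr_print_based_uniform)
open Summit.QuantumFields.YangMills.Theorems.PV3E (isMinOn_regFibrePr_of_reprLe)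

/-! ## §1 At one member and one datum: minimality of a critical configuration from Thm 2 at it and (142) in its chart -/

section Datum

/-- **STEPS (1)–(5) AT ONE MEMBER AND ONE DATUM.**  Let `U ∈ (6)(e) ∩ 𝔅_k(V)` with `e` below the displayed thresholds (`min{1/(6C₀(3)), c₂′(3,L)/4}`,
`(10⁸L³)⁻¹`, `(2 + 2C_L)e ≤ c₁`, `(2 + 2C_L)e ≤ c₇`, `C_L = 2(14336 + (21/20)((5L)²/4)(10800L + 1))`).  If [Balaban1985RegularSpaces] THEOREM 2 holds at
this member for the based letters (`hT2m`, the binder of `Prop7SPrintCond135.prop2Printed_sPrint_of_thm2` at `F, n, K`) and (142) holds in the chart around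
`U` at every radius `α ≤ c₇` (`hcom`), then `U` MINIMISES the Wilson action over (6)(e): axial representative (`axialRepr_print_based_uniform`) → (1.35)
(`cond135_based_of_sat14_mem`, `|Ū − V| = 0`) → Thm 2 → (142) → gauge invariance of (5).
[cite: Balaban1985Variational, (141)-(142) p.299, Prop. 2 p.281, (18) p.280; Balaban1985RegularSpaces, Thm 2 p.83, (1.35) p.82] -/
theorem isMinOn_regFibrePr_of_thm2_coercive142_at {L : ℕ} (F : T3Family) (hF : F.L = L) {n K : ℕ} (hnK : n < K) {B₁ c₁ c₇ e : ℝ}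
    (hT2m : ∀ (α₀ α₁ : ℝ), 0 < α₀ → 0 < α₁ → α₀ + α₁ ≤ c₁ →
      ∀ (U₀ U : GaugeField (F.P K) 0 (Matrix.specialUnitaryGroup (Fin 2) ℂ)),
        RegPr F n K α₀ U₀ → RegPr F n K α₀ U → IsAxialPrint F n K U₀ U →
        Cond135T (F.P K).L (K - n) (pull (bgUnits F K U₀) (basePt F n K)) (pull (bgUnits F K (pert U₀ U)) (basePt F n K)) α₁ →
        ∃ (u : GaugeTransf (F.P K) 0 (Matrix.specialUnitaryGroup (Fin 2) ℂ))
          (U₁ : GaugeField (F.P K) 0 (Matrix.specialUnitaryGroup (Fin 2) ℂ)) (A : PBond (F.P K) 0 → Matrix (Fin 2) (Fin 2) ℂ),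
          RestrictedPrint F n K U₀ u ∧ GaugeField.gaugeAct u (emb15 U₀ U₁) = U ∧ (∀ b : PBond (F.P K) 0, IsSelfAdjoint (A b)) ∧
          (∀ b : PBond (F.P K) 0,
            ((U₁ b : Matrix.specialUnitaryGroup (Fin 2) ℂ) : Matrix (Fin 2) (Fin 2) ℂ) = exp (Complex.I • ((eta F n K) • A b))) ∧
          (∃ (β₀ B₂ : ℝ) (len : LSite (F.P K).d → ℝ),
            B8Thm2TorusAt.C136T (F.P K).L (K - n) (eta F n K) β₀ B₁ B₂ len (α₀ + α₁) (pull (bgUnits F K U₀) (basePt F n K))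
              (pull A (basePt F n K))) ∧
          B8Eq138LandauZd.IsLandau138 (F.P K).L (K - n) (eta F n K) (Set.univ : Set (LSite (F.P K).d)) (B8Thm4TorusAt.torusLam (K - n))
            (pull (bgUnits F K U₀) (basePt F n K)) (pull A (basePt F n K)) ∧
          B8Thm2TorusAt.C139T (F.P K).L (K - n) (eta F n K) B₁ (α₀ + α₁) (pull (bgUnits F K U₀) (basePt F n K)) (pull A (basePt F n K)))
    {V : GaugeField (F.P n) 0 (Matrix.specialUnitaryGroup (Fin 2) ℂ)} {U : GaugeField (F.P K) 0 (Matrix.specialUnitaryGroup (Fin 2) ℂ)}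
    (hU : U ∈ regFibrePr F n K hnK.le e V)
    (hcom : ∀ (α : ℝ) (u : GaugeTransf (F.P K) 0 (Matrix.specialUnitaryGroup (Fin 2) ℂ))
      (U₁ : GaugeField (F.P K) 0 (Matrix.specialUnitaryGroup (Fin 2) ℂ)) (A : PBond (F.P K) 0 → Matrix (Fin 2) (Fin 2) ℂ),
      0 < α → α ≤ c₇ → RestrictedPrint F n K U u → (∀ b : PBond (F.P K) 0, IsSelfAdjoint (A b)) →
      (∀ b : PBond (F.P K) 0, ((U₁ b : Matrix.specialUnitaryGroup (Fin 2) ℂ) : Matrix (Fin 2) (Fin 2) ℂ) = exp (Complex.I • ((eta F n K) • A b))) →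
      (∃ (β₀ B₂ : ℝ) (len : LSite (F.P K).d → ℝ),
        B8Thm2TorusAt.C136T (F.P K).L (K - n) (eta F n K) β₀ B₁ B₂ len α (pull (bgUnits F K U) (basePt F n K)) (pull A (basePt F n K))) →
      B8Eq138LandauZd.IsLandau138 (F.P K).L (K - n) (eta F n K) (Set.univ : Set (LSite (F.P K).d)) (B8Thm4TorusAt.torusLam (K - n))
        (pull (bgUnits F K U) (basePt F n K)) (pull A (basePt F n K)) →
      B8Thm2TorusAt.C139T (F.P K).L (K - n) (eta F n K) B₁ α (pull (bgUnits F K U) (basePt F n K)) (pull A (basePt F n K)) →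
      GaugeField.gaugeAct u (emb15 U U₁) ∈ regFibrePr F n K hnK.le e V →
        wilsonAction4 U ≤ wilsonAction4 (emb15 U U₁))
    (heA : e ≤ min (1 / (6 * C0 3 * 1)) (c2' 3 L / (4 * 1))) (he8 : e ≤ (10 ^ 8 * (F.L : ℝ) ^ 3)⁻¹)
    (hec₁ : (2 + 2 * (2 * (14336 + 21 / 20 * (((5 * (F.L : ℝ)) ^ 2 / 4) * (10800 * (F.L : ℝ) + 1))))) * e ≤ c₁)
    (hec₇ : (2 + 2 * (2 * (14336 + 21 / 20 * (((5 * (F.L : ℝ)) ^ 2 / 4) * (10800 * (F.L : ℝ) + 1))))) * e ≤ c₇) :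
    IsMinOn (fun W' : GaugeField (F.P K) 0 (Matrix.specialUnitaryGroup (Fin 2) ℂ) => wilsonAction4 W') (regFibrePr F n K hnK.le e V) U := by
  set CL : ℝ := 2 * (14336 + 21 / 20 * (((5 * (F.L : ℝ)) ^ 2 / 4) * (10800 * (F.L : ℝ) + 1))) with hCL_def
  have hCL0 : 0 ≤ CL := by positivity
  obtain ⟨hUfib, hUreg⟩ := (mem_regFibrePr_iff F).mp hU
  have he0 : 0 < e := pos_of_regPr F hUreg
  refine isMinOn_regFibrePr_of_reprLe F hnK.le V U fun W hW => ?_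
  obtain ⟨-, hWreg⟩ := (mem_regFibrePr_iff F).mp hW
  -- (1) the axial representative `W^v`, `v↓ = 1` (background `U`, radii `C₁ = B₃ = 1`, `ε₁ = ε₀ = e`)
  have h14 : Sat14T3 F n K hnK.le (1 * 1 * e) (1 * e) V U := by
    refine ⟨by rw [one_mul, one_mul]; exact hUreg, ?_⟩
    rw [one_mul]; exact closeAvg_of_mem_fibre he0 hUfib
  obtain ⟨v, hv, hvAx⟩ := axialRepr_print_based_uniform F hF hnK.le le_rfl 1 e e V U W heA (by rw [one_mul]) h14 hW
  have hvW : GaugeField.gaugeAct v W ∈ regFibrePr F n K hnK.le e V := (gaugeAct_mem_regFibrePr_iff_of_trivial F hnK.le he0.le hv W V).mpr hW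
  have hvWreg : RegPr F n K e (GaugeField.gaugeAct v W) := ((mem_regFibrePr_iff F).mp hvW).2
  have hax : IsAxialPrint F n K U (GaugeField.gaugeAct v W) := hvAx (torusLam (K - n))
  -- (2) hypothesis (1.35) for the pair `(U, W^v)`, `α₁ = e + C_L·(e + e)`
  have h135 := cond135_based_of_sat14_mem F hnK hUreg (closeAvg_of_mem_fibre he0 hUfib) hvW he8 he8
  -- (3) Theorem 2 at the background `U`
  have hα₁ : 0 < e + CL * (e + e) := by positivity
  have hsum : e + (e + CL * (e + e)) ≤ c₁ := by
    have : e + (e + CL * (e + e)) = (2 + 2 * CL) * e := by ring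
    rw [this]; exact hec₁
  obtain ⟨u, U₁, A, hru, hgauge, hA, hexp, h136, h138, h139⟩ :=
    hT2m e (e + CL * (e + e)) he0 hα₁ hsum U (GaugeField.gaugeAct v W) hUreg hvWreg hax h135
  -- (4) the Sect.-E statement (142) in the chart around `U`, radius `α = (2 + 2C_L)e ≤ c₇`
  have hα0 : 0 < e + (e + CL * (e + e)) := by positivity
  have hα7 : e + (e + CL * (e + e)) ≤ c₇ := by
    have : e + (e + CL * (e + e)) = (2 + 2 * CL) * e := by ring
    rw [this]; exact hec₇
  have hmem : GaugeField.gaugeAct u (emb15 U U₁) ∈ regFibrePr F n K hnK.le e V := by rw [hgauge]; exact hvW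
  have h142 := hcom _ u U₁ A hα0 hα7 hru hA hexp h136 h138 h139 hmem
  -- (5) gauge invariance of (5): `A(W^v) = A((U₁U)^u) = A(U₁U) ≥ A(U)`
  refine ⟨v, ?_⟩
  rw [← hgauge, show wilsonAction4 (GaugeField.gaugeAct u (emb15 U U₁)) = wilsonAction4 (emb15 U U₁) from
    T4WilsonGaugeFlatDirection.wilsonAction_gaugeAct 1 u (emb15 U U₁)]
  exact h142

end Datum

/-! ## §2 The E′ text of record from `hT2` (Theorem 2, the cell's socket) and `hco` ((142) in the chart at critical backgrounds) -/

/-- **ROW E′ OF SKELETON v9 (OWNER RULING g24-№3) ON PRINT'S OWN ROUTE, FROM TWO DISPLAYED HYPOTHESES**: `hT2` = [Balaban1985RegularSpaces] THEOREM 2 for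
the based letters at every member of block size `L` (the binder of `Prop7SPrintCond135.prop2Printed_sPrint_of_thm2` — the socket the cell books for row A,
here read at the CRITICAL background; general regular competitor in the axial gauge (1.19) under (1.35)), and `hco` = [Balaban1985Variational] (142) in the
Landau-gauge chart (19)–(21) around every reading-R2 critical `U ∈ (6)(e) ∩ 𝔅_k(V)`: every chart point `U₁U`, `U₁ = e^{iηA}` with (1.36)–(1.39) at radius
`α ≤ c₇`, whose (1.29)-restricted `u`-image lies in (6)(e) ∩ 𝔅_k(V), has `A(U₁U) ≥ A(U)` (constants `e₇, c₇ > 0` depending on `L` and Thm 2's `B₁`).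
CONCLUSION = the E′ text verbatim (`e₅` = the minimum of the six thresholds of `isMinOn_regFibrePr_of_thm2_coercive142_at` and `e₇`, `a₁'' = 1`).
[cite: Balaban1985Variational, (141)-(142) p.299, Prop. 7 p.299, (4)-(7) p.278, (14)-(18) p.280, (19)-(21) p.281; Balaban1985RegularSpaces, Thm 2 p.83] -/
theorem stub_PV3E_of_thm2_coercive142
    (hT2 : ∀ (L : ℕ), 1 < L → ∃ B₁ c₁ : ℝ, 0 < B₁ ∧ 0 < c₁ ∧
      ∀ (F : T3Family), F.L = L → ∀ (n K : ℕ), n < K → ∀ (α₀ α₁ : ℝ), 0 < α₀ → 0 < α₁ → α₀ + α₁ ≤ c₁ →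
      ∀ (U₀ U : GaugeField (F.P K) 0 (Matrix.specialUnitaryGroup (Fin 2) ℂ)),
        RegPr F n K α₀ U₀ → RegPr F n K α₀ U → IsAxialPrint F n K U₀ U →
        Cond135T (F.P K).L (K - n) (pull (bgUnits F K U₀) (basePt F n K)) (pull (bgUnits F K (pert U₀ U)) (basePt F n K)) α₁ →
        ∃ (u : GaugeTransf (F.P K) 0 (Matrix.specialUnitaryGroup (Fin 2) ℂ))
          (U₁ : GaugeField (F.P K) 0 (Matrix.specialUnitaryGroup (Fin 2) ℂ)) (A : PBond (F.P K) 0 → Matrix (Fin 2) (Fin 2) ℂ),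
          RestrictedPrint F n K U₀ u ∧ GaugeField.gaugeAct u (emb15 U₀ U₁) = U ∧ (∀ b : PBond (F.P K) 0, IsSelfAdjoint (A b)) ∧
          (∀ b : PBond (F.P K) 0,
            ((U₁ b : Matrix.specialUnitaryGroup (Fin 2) ℂ) : Matrix (Fin 2) (Fin 2) ℂ) = exp (Complex.I • ((eta F n K) • A b))) ∧
          (∃ (β₀ B₂ : ℝ) (len : LSite (F.P K).d → ℝ),
            B8Thm2TorusAt.C136T (F.P K).L (K - n) (eta F n K) β₀ B₁ B₂ len (α₀ + α₁) (pull (bgUnits F K U₀) (basePt F n K))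
              (pull A (basePt F n K))) ∧
          B8Eq138LandauZd.IsLandau138 (F.P K).L (K - n) (eta F n K) (Set.univ : Set (LSite (F.P K).d)) (B8Thm4TorusAt.torusLam (K - n))
            (pull (bgUnits F K U₀) (basePt F n K)) (pull A (basePt F n K)) ∧
          B8Thm2TorusAt.C139T (F.P K).L (K - n) (eta F n K) B₁ (α₀ + α₁) (pull (bgUnits F K U₀) (basePt F n K)) (pull A (basePt F n K)))
    (hco : ∀ (L : ℕ), 1 < L → ∀ (B₁ : ℝ), 0 < B₁ → ∃ e₇ c₇ : ℝ, 0 < e₇ ∧ 0 < c₇ ∧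
      ∀ (F : T3Family), F.L = L → ∀ (n K : ℕ) (hnK : n < K) (e α : ℝ) (V : GaugeField (F.P n) 0 (Matrix.specialUnitaryGroup (Fin 2) ℂ))
        (U U₁ : GaugeField (F.P K) 0 (Matrix.specialUnitaryGroup (Fin 2) ℂ)) (u : GaugeTransf (F.P K) 0 (Matrix.specialUnitaryGroup (Fin 2) ℂ))
        (A : PBond (F.P K) 0 → Matrix (Fin 2) (Fin 2) ℂ),
        0 < e → e ≤ e₇ → 0 < α → α ≤ c₇ → U ∈ regFibrePr F n K hnK.le e V → IsCritR2 F n K hnK.le V U →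
        RestrictedPrint F n K U u → (∀ b : PBond (F.P K) 0, IsSelfAdjoint (A b)) →
        (∀ b : PBond (F.P K) 0, ((U₁ b : Matrix.specialUnitaryGroup (Fin 2) ℂ) : Matrix (Fin 2) (Fin 2) ℂ) = exp (Complex.I • ((eta F n K) • A b))) →
        (∃ (β₀ B₂ : ℝ) (len : LSite (F.P K).d → ℝ),
          B8Thm2TorusAt.C136T (F.P K).L (K - n) (eta F n K) β₀ B₁ B₂ len α (pull (bgUnits F K U) (basePt F n K)) (pull A (basePt F n K))) →
        B8Eq138LandauZd.IsLandau138 (F.P K).L (K - n) (eta F n K) (Set.univ : Set (LSite (F.P K).d)) (B8Thm4TorusAt.torusLam (K - n))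
          (pull (bgUnits F K U) (basePt F n K)) (pull A (basePt F n K)) →
        B8Thm2TorusAt.C139T (F.P K).L (K - n) (eta F n K) B₁ α (pull (bgUnits F K U) (basePt F n K)) (pull A (basePt F n K)) →
        GaugeField.gaugeAct u (emb15 U U₁) ∈ regFibrePr F n K hnK.le e V →
          wilsonAction4 U ≤ wilsonAction4 (emb15 U U₁)) :
    ∀ (L : ℕ), 1 < L → ∀ (B₃ : ℝ), 4 < B₃ →
    ∃ e₅ a₁'' : ℝ, 0 < e₅ ∧ 0 < a₁'' ∧ ∀ (i : Idx L) (e ε₁ : ℝ) (V : GaugeField (i.1.1.P i.1.2.1) 0 (Matrix.specialUnitaryGroup (Fin 2) ℂ))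
      (U₀ W : GaugeField (i.1.1.P i.1.2.2) 0 (Matrix.specialUnitaryGroup (Fin 2) ℂ)),
      0 < ε₁ → ε₁ ≤ a₁'' → PlaqSmall ε₁ V → (L : ℝ) ^ 3 * B₃ * ε₁ ≤ e → e ≤ e₅ →
      RegPr i.1.1 i.1.2.1 i.1.2.2 ((L : ℝ) ^ 3 * B₃ * ε₁) U₀ → CloseAvg i.1.1 i.1.2.1 i.1.2.2 i.2.2.le ((L : ℝ) ^ 3 * ε₁) V U₀ →
      W ∈ regFibrePr i.1.1 i.1.2.1 i.1.2.2 i.2.2.le e V → IsCritR2 i.1.1 i.1.2.1 i.1.2.2 i.2.2.le V W →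
        IsMinOn (fun W' : GaugeField (i.1.1.P i.1.2.2) 0 (Matrix.specialUnitaryGroup (Fin 2) ℂ) => wilsonAction4 W')
          (regFibrePr i.1.1 i.1.2.1 i.1.2.2 i.2.2.le e V) W := by
  intro L hL B₃ hB₃
  obtain ⟨B₁, c₁, hB₁, hc₁, HT2⟩ := hT2 L hL
  obtain ⟨e₇, c₇, he₇, hc₇, HCO⟩ := hco L hL B₁ hB₁
  have hL0 : (0 : ℝ) < (L : ℝ) := by exact_mod_cast (show 0 < L by omega)
  -- the constant `C_L` of row (C135) and the six thresholds
  set CL : ℝ := 2 * (14336 + 21 / 20 * (((5 * (L : ℝ)) ^ 2 / 4) * (10800 * (L : ℝ) + 1))) with hCL_def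
  have hD : 0 < 2 + 2 * CL := by positivity
  have hA0 : 0 < min (1 / (6 * C0 3 * 1)) (c2' 3 L / (4 * 1)) :=
    lt_min (by have := C0_pos 3; positivity) (by have := c2'_pos 3 L (by omega); positivity)
  refine ⟨min (min e₇ (min (1 / (6 * C0 3 * 1)) (c2' 3 L / (4 * 1)))) (min ((10 ^ 8 * (L : ℝ) ^ 3)⁻¹) (min (c₁ / (2 + 2 * CL)) (c₇ / (2 + 2 * CL)))),
    1, lt_min (lt_min he₇ hA0) (lt_min (by positivity) (lt_min (by positivity) (by positivity))), one_pos, ?_⟩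
  intro i e ε₁ V U₀ W hε₁ _hε₁a _hV hlo hhi _hRU₀ _hclose hW hWcrit
  obtain ⟨⟨F, n, K⟩, hF, hnK⟩ := i
  have he0 : 0 < e := lt_of_lt_of_le (by positivity) hlo
  have he₇' : e ≤ e₇ := hhi.trans ((min_le_left _ _).trans (min_le_left _ _))
  have heA : e ≤ min (1 / (6 * C0 3 * 1)) (c2' 3 L / (4 * 1)) := hhi.trans ((min_le_left _ _).trans (min_le_right _ _))
  have he8 : e ≤ (10 ^ 8 * (L : ℝ) ^ 3)⁻¹ := hhi.trans ((min_le_right _ _).trans (min_le_left _ _))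
  have hec₁ : e ≤ c₁ / (2 + 2 * CL) := hhi.trans ((min_le_right _ _).trans ((min_le_right _ _).trans (min_le_left _ _)))
  have hec₇ : e ≤ c₇ / (2 + 2 * CL) := hhi.trans ((min_le_right _ _).trans ((min_le_right _ _).trans (min_le_right _ _)))
  have hFL : (F.L : ℝ) = (L : ℝ) := by exact_mod_cast hF
  refine isMinOn_regFibrePr_of_thm2_coercive142_at F hF hnK (HT2 F hF n K hnK) hW
    (fun α u U₁ A hα hαc hru hA hexp h136 h138 h139 hmem =>
      HCO F hF n K hnK e α V W U₁ u A he0 he₇' hα hαc hW hWcrit hru hA hexp h136 h138 h139 hmem)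
    heA (by rw [hFL]; exact he8) ?_ ?_
  · rw [hFL]
    have h1 := (le_div_iff₀ hD).1 hec₁
    rw [hCL_def] at h1
    linarith
  · rw [hFL]
    have h1 := (le_div_iff₀ hD).1 hec₇
    rw [hCL_def] at h1
    linarith

end Summit.QuantumFields.YangMills.Theorems.PV3EChart

end
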